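import Summits.NavierStokesRegularity.FluidComputer.PalasekTowerTinyBlob
import Literature.Analysis.FluidPDE.AxisymSmallSwirlL4
import Literature.Analysis.FluidPDE.AxisymQuotientRayAverage
import Literature.Analysis.FluidPDE.AxisymmetricVorticityTransport
import Literature.Analysis.FluidPDE.VorticityCalculus
import Literature.Analysis.FluidPDE.VectorCalculusProofs

/-!
# The COAXIAL POLOIDAL RING PUSHER: an explicit axisymmetric SWIRL-FREE compactly supported divergence-free
# field on the axis above the blob (the sterile replacement of `faintPusher` in the strict slot)

Cell `ns-blowup`, seat `ns-blowup-fc-prover-2` (g11; D-0074 GROUP C «BRIDGE SUPPORT»). Route `PalasekTowerBreakdown`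
(rev 19): crux stmt-NavierStokesRegularity-20303 `EpisodeBaseT`, heredity pair 20304 / 20305; stub D2
`SterileMechanismDoorT` of the strategist's line `Cruxes/EpisodeBaseT/Lines/doormirror.lean` («the mechanism door walked
STERILE»). LABEL: E–C typing (KERNEL construction: definitions with body — two bump profiles, the potential, the ring
pusher and its two coefficients, the shell region — and their calculus; everything proved). WHAT THIS IS NOT: not
Navier–Stokes evidence — ONE explicit compactly supported vector field; no flow, stage, schedule or certificate.

The tame carrier of record (`PalasekTowerTameCarrierAt`, ecbridge-3) fills the strict slot `LevelZeroDataAt R · 7` with the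
flat even blob plus `faintPusher μ = μ ∇ψ × Y₀e₃` — horizontal velocities orthogonal to the radial direction, i.e. an
axisymmetric field of PURE SWIRL; so the door of record registers a design WITH swirl even for a sterile amplifier and K201's
swirl-free stratum is out of reach (ecbridge-3 STATUS l.10301 (1); card `doormirror.md`, stub D2). The sterile replacement:

  `ringPusher δ = curl (Φ_δ • J)`, `Φ_δ(x) = f(x₀² + x₁²) · η((x₂ − 5)/δ)`, `J x = (−x₁, x₀, 0)`,

`f` a smooth bump of `s = x₀² + x₁²` supported in `[1/4, 3/4]`, `η` a smooth bump supported in `[−2, 2]` (Mathlib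
`ContDiffBump`). In components (`curl_smul_rotGenL_apply_zero/one`):
`ringPusher δ x = α_δ(x) · (x₀, x₁, 0) + β_δ(x) · e₃`, `α_δ = −f(s) η′(t)/δ`, `β_δ = 2 (f(s) + s f′(s)) η(t)`,
`t = (x₂ − 5)/δ` — a thin coaxial «pancake» vortex ring of mostly RADIAL velocity at height `5`. Proved: smooth, divergence
free (`div curl = 0`), AXISYMMETRIC (`IsAxisymmetric.curl`), SWIRL FREE (`swirl_curl_smul_rotGenL`), vanishing off the closed
shell `{s ≤ 3/4, 9/2 ≤ x₂ ≤ 11/2} ⊆ {9/2 ≤ ‖x‖ ≤ 28/5}` for `0 < δ ≤ 1/4`, `‖ringPusher δ x‖² = s α² + β²`. The SIGN of its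
strict-anchor integral (the one analytic step of D2) is the sequel `PalasekTowerRingPusherSign`.

References: A. J. Majda, A. L. Bertozzi, *Vorticity and Incompressible Flow* (CUP 2002), §1.1, §2.3.3
[cite: MajdaBertozziCUP2002, §1.1 (vector identities)]; S. Palasek, arXiv:2605.13827 §3.3 [cite: Palasek2026ElementaryModel, §3.3].
-/

noncomputable section

namespace Summit.NavierStokesRegularity.FluidComputer.PalasekTowerClayBridge.Germ

open Set Function Filter Topology InnerProductSpace Metric MeasureTheory Real
open scoped Topology ContDiff RealInnerProductSpace

open Literature.Analysis.FluidPDE TinyBlob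

/-! ## §1 The two bump profiles -/

/-- The radial bump (in the variable `s = x₀² + x₁²`): centre `1/2`, `= 1` on `[3/8, 5/8]`, supported in `[1/4, 3/4]`.
[folklore] -/
def ringRadBump : ContDiffBump (1 / 2 : ℝ) := ⟨1 / 8, 1 / 4, by norm_num, by norm_num⟩

/-- The axial bump: centre `0`, `= 1` on `[−1, 1]`, supported in `[−2, 2]`. [folklore] -/
def ringAxBump : ContDiffBump (0 : ℝ) := ⟨1, 2, by norm_num, by norm_num⟩

/-- The radial profile `f : ℝ → ℝ` of the ring pusher (the radial bump as a function). [folklore] -/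
def ringRad (σ : ℝ) : ℝ := ringRadBump σ

/-- The axial profile `η : ℝ → ℝ` of the ring pusher (the axial bump as a function). [folklore] -/
def ringAx (t : ℝ) : ℝ := ringAxBump t

/-- `f` is smooth. [folklore] -/
theorem contDiff_ringRad : ContDiff ℝ ∞ ringRad := ringRadBump.contDiff

/-- `η` is smooth. [folklore] -/
theorem contDiff_ringAx : ContDiff ℝ ∞ ringAx := ringAxBump.contDiff

/-- `f` is differentiable. [folklore] -/
theorem differentiable_ringRad : Differentiable ℝ ringRad := contDiff_ringRad.differentiable (by simp)

/-- `η` is differentiable. [folklore] -/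
theorem differentiable_ringAx : Differentiable ℝ ringAx := contDiff_ringAx.differentiable (by simp)

/-- `tsupport f = [1/4, 3/4]` (a closed ball of radius `1/4` about `1/2`). [folklore] -/
theorem tsupport_ringRad : tsupport ringRad = closedBall (1 / 2 : ℝ) (1 / 4) := ringRadBump.tsupport_eq

/-- `tsupport η = [−2, 2]`. [folklore] -/
theorem tsupport_ringAx : tsupport ringAx = closedBall (0 : ℝ) 2 := ringAxBump.tsupport_eq

/-- Off `|σ − 1/2| ≤ 1/4` both `f` and `f′` vanish. [folklore] -/
theorem ringRad_and_deriv_eq_zero {σ : ℝ} (h : 1 / 4 < |σ - 1 / 2|) : ringRad σ = 0 ∧ deriv ringRad σ = 0 := by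
  have hn : σ ∉ tsupport ringRad := by
    rw [tsupport_ringRad, mem_closedBall, Real.dist_eq]; exact not_le.2 h
  exact ⟨image_eq_zero_of_notMem_tsupport hn, notMem_support.1 fun hs => hn (support_deriv_subset hs)⟩

/-- Off `|t| ≤ 2` both `η` and `η′` vanish. [folklore] -/
theorem ringAx_and_deriv_eq_zero {t : ℝ} (h : 2 < |t|) : ringAx t = 0 ∧ deriv ringAx t = 0 := by
  have hn : t ∉ tsupport ringAx := by
    rw [tsupport_ringAx, mem_closedBall, Real.dist_eq, sub_zero]; exact not_le.2 h
  exact ⟨image_eq_zero_of_notMem_tsupport hn, notMem_support.1 fun hs => hn (support_deriv_subset hs)⟩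

/-- For `s > 3/4` (and `s ≥ 0` irrelevant): `f(s) = f′(s) = 0`. [folklore] -/
theorem ringRad_and_deriv_eq_zero_of_gt {σ : ℝ} (h : 3 / 4 < σ) : ringRad σ = 0 ∧ deriv ringRad σ = 0 :=
  ringRad_and_deriv_eq_zero (by rw [abs_of_pos (by linarith)]; linarith)

/-! ## §2 The potential `Φ_δ` and its derivative -/

/-- The horizontal square radius `s(x) = x₀² + x₁²`. [folklore] -/
def hsq (x : EuclideanSpace ℝ (Fin 3)) : ℝ := x 0 ^ 2 + x 1 ^ 2

/-- `s ≥ 0`. [folklore] -/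
theorem hsq_nonneg (x : EuclideanSpace ℝ (Fin 3)) : 0 ≤ hsq x := by unfold hsq; positivity

/-- `‖x‖² = s + x₂²`. [folklore] -/
theorem norm_sq_eq_hsq_add (x : EuclideanSpace ℝ (Fin 3)) : ‖x‖ ^ 2 = hsq x + x 2 ^ 2 := by
  rw [EuclideanSpace.norm_sq_eq, Fin.sum_univ_three]
  simp only [Real.norm_eq_abs, sq_abs, hsq]

/-- `s(R_θ x) = s(x)`. [folklore] -/
theorem hsq_rotZ (θ : ℝ) (x : EuclideanSpace ℝ (Fin 3)) : hsq (rotZ θ x) = hsq x := by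
  simp only [hsq, rotZ_apply_zero, rotZ_apply_one]
  linear_combination (x 0 ^ 2 + x 1 ^ 2) * Real.sin_sq_add_cos_sq θ

/-- `Ds(x) = 2x₀ dx₀ + 2x₁ dx₁`. [folklore] -/
theorem hasFDerivAt_hsq (x : EuclideanSpace ℝ (Fin 3)) :
    HasFDerivAt hsq ((2 * x 0) • (EuclideanSpace.proj (0 : Fin 3) : EuclideanSpace ℝ (Fin 3) →L[ℝ] ℝ) +
      (2 * x 1) • (EuclideanSpace.proj (1 : Fin 3) : EuclideanSpace ℝ (Fin 3) →L[ℝ] ℝ)) x := by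
  have hp : ∀ i : Fin 3, HasFDerivAt (fun z : EuclideanSpace ℝ (Fin 3) => z i)
      (EuclideanSpace.proj i : EuclideanSpace ℝ (Fin 3) →L[ℝ] ℝ) x := fun i =>
    (EuclideanSpace.proj i : EuclideanSpace ℝ (Fin 3) →L[ℝ] ℝ).hasFDerivAt
  have h0 := (hp 0).mul (hp 0)
  have h1 := (hp 1).mul (hp 1)
  have h := h0.add h1
  have hfun : hsq = fun z : EuclideanSpace ℝ (Fin 3) => z 0 * z 0 + z 1 * z 1 := by
    funext z; simp only [hsq, sq]
  rw [hfun]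
  refine h.congr_fderiv ?_
  ext v
  simp only [_root_.add_apply, _root_.smul_apply, smul_eq_mul, PiLp.proj_apply]
  ring

/-- `s` is smooth. [folklore] -/
theorem contDiff_hsq : ContDiff ℝ ∞ hsq := by
  unfold hsq
  fun_prop

/-- **The potential** `Φ_δ(x) = f(s(x)) · η((x₂ − 5)/δ)`. [folklore] -/
def ringPot (δ : ℝ) (x : EuclideanSpace ℝ (Fin 3)) : ℝ := ringRad (hsq x) * ringAx ((x 2 - 5) / δ)

/-- `Φ_δ` is smooth. [folklore] -/
theorem contDiff_ringPot (δ : ℝ) : ContDiff ℝ ∞ (ringPot δ) := by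
  have h2 : ContDiff ℝ ∞ fun x : EuclideanSpace ℝ (Fin 3) => (x 2 - 5) / δ :=
    (((EuclideanSpace.proj (2 : Fin 3) : EuclideanSpace ℝ (Fin 3) →L[ℝ] ℝ).contDiff).sub contDiff_const).div_const _
  exact (contDiff_ringRad.comp contDiff_hsq).mul (contDiff_ringAx.comp h2)

/-- `Φ_δ` is differentiable. [folklore] -/
theorem differentiable_ringPot (δ : ℝ) : Differentiable ℝ (ringPot δ) :=
  (contDiff_ringPot δ).differentiable (by simp)

/-- **The derivative of the potential**:
`DΦ_δ(x) = f(s) η′(t) δ⁻¹ dx₂ + η(t) f′(s) (2x₀ dx₀ + 2x₁ dx₁)`, `t = (x₂ − 5)/δ`. [folklore] -/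
theorem hasFDerivAt_ringPot (δ : ℝ) (x : EuclideanSpace ℝ (Fin 3)) :
    HasFDerivAt (ringPot δ)
      (ringRad (hsq x) • ((deriv ringAx ((x 2 - 5) / δ) * δ⁻¹) •
          (EuclideanSpace.proj (2 : Fin 3) : EuclideanSpace ℝ (Fin 3) →L[ℝ] ℝ)) +
        ringAx ((x 2 - 5) / δ) • (deriv ringRad (hsq x) •
          ((2 * x 0) • (EuclideanSpace.proj (0 : Fin 3) : EuclideanSpace ℝ (Fin 3) →L[ℝ] ℝ) +
            (2 * x 1) • (EuclideanSpace.proj (1 : Fin 3) : EuclideanSpace ℝ (Fin 3) →L[ℝ] ℝ)))) x := by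
  -- the radial factor
  have hA : HasFDerivAt (fun z => ringRad (hsq z)) (deriv ringRad (hsq x) •
      ((2 * x 0) • (EuclideanSpace.proj (0 : Fin 3) : EuclideanSpace ℝ (Fin 3) →L[ℝ] ℝ) +
        (2 * x 1) • (EuclideanSpace.proj (1 : Fin 3) : EuclideanSpace ℝ (Fin 3) →L[ℝ] ℝ))) x :=
    ((differentiable_ringRad (hsq x)).hasDerivAt).comp_hasFDerivAt x (hasFDerivAt_hsq x)
  -- the axial factor
  have ht : HasFDerivAt (fun z : EuclideanSpace ℝ (Fin 3) => (z 2 - 5) / δ)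
      (δ⁻¹ • (EuclideanSpace.proj (2 : Fin 3) : EuclideanSpace ℝ (Fin 3) →L[ℝ] ℝ)) x := by
    have hp : HasFDerivAt (fun z : EuclideanSpace ℝ (Fin 3) => z 2)
        (EuclideanSpace.proj (2 : Fin 3) : EuclideanSpace ℝ (Fin 3) →L[ℝ] ℝ) x :=
      (EuclideanSpace.proj (2 : Fin 3) : EuclideanSpace ℝ (Fin 3) →L[ℝ] ℝ).hasFDerivAt
    have h := (hp.sub_const 5).mul_const δ⁻¹
    have hfun : (fun z : EuclideanSpace ℝ (Fin 3) => (z 2 - 5) / δ) =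
        fun z : EuclideanSpace ℝ (Fin 3) => (z 2 - 5) * δ⁻¹ := by
      funext z; rw [div_eq_mul_inv]
    rw [hfun]
    refine h.congr_fderiv ?_
    ext v
    simp only [_root_.smul_apply, smul_eq_mul, PiLp.proj_apply]
  have hB : HasFDerivAt (fun z : EuclideanSpace ℝ (Fin 3) => ringAx ((z 2 - 5) / δ))
      ((deriv ringAx ((x 2 - 5) / δ) * δ⁻¹) •
        (EuclideanSpace.proj (2 : Fin 3) : EuclideanSpace ℝ (Fin 3) →L[ℝ] ℝ)) x := by
    have h := ((differentiable_ringAx ((x 2 - 5) / δ)).hasDerivAt).comp_hasFDerivAt x ht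
    rw [smul_smul] at h
    exact h
  exact hA.mul hB

/-- `∂₀Φ_δ = 2x₀ f′(s) η(t)`. [folklore] -/
theorem fderiv_ringPot_single_zero (δ : ℝ) (x : EuclideanSpace ℝ (Fin 3)) :
    fderiv ℝ (ringPot δ) x (EuclideanSpace.single 0 1) =
      2 * x 0 * deriv ringRad (hsq x) * ringAx ((x 2 - 5) / δ) := by
  rw [(hasFDerivAt_ringPot δ x).fderiv]
  simp; ring

/-- `∂₁Φ_δ = 2x₁ f′(s) η(t)`. [folklore] -/
theorem fderiv_ringPot_single_one (δ : ℝ) (x : EuclideanSpace ℝ (Fin 3)) :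
    fderiv ℝ (ringPot δ) x (EuclideanSpace.single 1 1) =
      2 * x 1 * deriv ringRad (hsq x) * ringAx ((x 2 - 5) / δ) := by
  rw [(hasFDerivAt_ringPot δ x).fderiv]
  simp; ring

/-- `∂₂Φ_δ = f(s) η′(t)/δ`. [folklore] -/
theorem fderiv_ringPot_single_two (δ : ℝ) (x : EuclideanSpace ℝ (Fin 3)) :
    fderiv ℝ (ringPot δ) x (EuclideanSpace.single 2 1) =
      ringRad (hsq x) * deriv ringAx ((x 2 - 5) / δ) / δ := by
  rw [(hasFDerivAt_ringPot δ x).fderiv]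
  simp [div_eq_mul_inv, mul_assoc]

/-! ## §3 The ring pusher -/

/-- **THE RING PUSHER** `ringPusher δ = curl (Φ_δ • J)`, `J x = (−x₁, x₀, 0)`.
[cite: MajdaBertozziCUP2002, §1.1 (vector identities)] -/
def ringPusher (δ : ℝ) : EuclideanSpace ℝ (Fin 3) → EuclideanSpace ℝ (Fin 3) :=
  curl fun y => ringPot δ y • rotGenL y

/-- The radial coefficient `α_δ(x) = −f(s) η′(t)/δ`. [folklore] -/
def ringAlpha (δ : ℝ) (x : EuclideanSpace ℝ (Fin 3)) : ℝ :=
  -(ringRad (hsq x) * deriv ringAx ((x 2 - 5) / δ) / δ)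

/-- The axial coefficient `β_δ(x) = 2 (f(s) + s f′(s)) η(t)`. [folklore] -/
def ringBeta (δ : ℝ) (x : EuclideanSpace ℝ (Fin 3)) : ℝ :=
  2 * (ringRad (hsq x) + hsq x * deriv ringRad (hsq x)) * ringAx ((x 2 - 5) / δ)

/-- The potential field `Φ_δ • J` is smooth. [folklore] -/
theorem contDiff_ringPot_smul_rotGen (δ : ℝ) : ContDiff ℝ ∞ fun y => ringPot δ y • rotGenL y :=
  (contDiff_ringPot δ).smul rotGenL.contDiff

/-- **The ring pusher is smooth.** [folklore] -/
theorem contDiff_ringPusher (δ : ℝ) : ContDiff ℝ ∞ (ringPusher δ) := by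
  have h : ContDiff ℝ ((⊤ : ℕ∞) + 1 : ℕ∞) (fun y => ringPot δ y • rotGenL y) := by
    simpa using contDiff_ringPot_smul_rotGen δ
  exact contDiff_curl h

/-- The ring pusher is continuous. [folklore] -/
theorem continuous_ringPusher (δ : ℝ) : Continuous (ringPusher δ) := (contDiff_ringPusher δ).continuous

/-- **The ring pusher is divergence free** (`div curl = 0`). [cite: MajdaBertozziCUP2002, §1.1 (vector identities)] -/
theorem isDivFree_ringPusher (δ : ℝ) : VectorCalculus.IsDivFree (ringPusher δ) := fun x =>
  divergence_curl_eq_zero_holds _ ((contDiff_ringPot_smul_rotGen δ).of_le (by norm_cast)) x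

/-- **Component `0`**: `(ringPusher δ x)₀ = α_δ(x) x₀`. [folklore] -/
theorem ringPusher_apply_zero (δ : ℝ) (x : EuclideanSpace ℝ (Fin 3)) :
    ringPusher δ x 0 = ringAlpha δ x * x 0 := by
  rw [ringPusher, curl_smul_rotGenL_apply_zero (differentiable_ringPot δ x), fderiv_ringPot_single_two,
    ringAlpha]
  ring

/-- **Component `1`**: `(ringPusher δ x)₁ = α_δ(x) x₁`. [folklore] -/
theorem ringPusher_apply_one (δ : ℝ) (x : EuclideanSpace ℝ (Fin 3)) :
    ringPusher δ x 1 = ringAlpha δ x * x 1 := by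
  rw [ringPusher, curl_smul_rotGenL_apply_one (differentiable_ringPot δ x), fderiv_ringPot_single_two,
    ringAlpha]
  ring

/-- **Component `2`**: `(ringPusher δ x)₂ = β_δ(x)` (`= x₀∂₀Φ + x₁∂₁Φ + 2Φ`). [folklore] -/
theorem ringPusher_apply_two (δ : ℝ) (x : EuclideanSpace ℝ (Fin 3)) :
    ringPusher δ x 2 = ringBeta δ x := by
  have hd := differentiable_ringPot δ x
  rw [ringPusher, curl_apply_two, fderiv_smul_rotGenL_apply hd, fderiv_smul_rotGenL_apply hd,
    fderiv_ringPot_single_zero, fderiv_ringPot_single_one]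
  simp [rotGen, ringBeta, hsq, ringPot]
  ring

/-- `⟪x, ringPusher δ x⟫ = α s + β x₂`. [folklore] -/
theorem inner_self_ringPusher (δ : ℝ) (x : EuclideanSpace ℝ (Fin 3)) :
    ⟪x, ringPusher δ x⟫ = ringAlpha δ x * hsq x + ringBeta δ x * x 2 := by
  simp only [PiLp.inner_apply, RCLike.inner_apply, conj_trivial, Fin.sum_univ_three, ringPusher_apply_zero,
    ringPusher_apply_one, ringPusher_apply_two, hsq]
  ring

/-- `⟪ringPusher δ x, e₃⟫ = β`. [folklore] -/
theorem inner_ringPusher_e₃ (δ : ℝ) (x : EuclideanSpace ℝ (Fin 3)) : ⟪ringPusher δ x, e₃⟫ = ringBeta δ x := by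
  rw [inner_e₃_right, ringPusher_apply_two]

/-- **The speed**: `‖ringPusher δ x‖² = s α² + β²`. [folklore] -/
theorem norm_ringPusher_sq (δ : ℝ) (x : EuclideanSpace ℝ (Fin 3)) :
    ‖ringPusher δ x‖ ^ 2 = hsq x * ringAlpha δ x ^ 2 + ringBeta δ x ^ 2 := by
  rw [EuclideanSpace.norm_sq_eq, Fin.sum_univ_three]
  simp only [Real.norm_eq_abs, sq_abs, ringPusher_apply_zero, ringPusher_apply_one, ringPusher_apply_two, hsq]
  ring

/-! ## §4 Sterility: axisymmetric and swirl free -/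

/-- `Φ_δ` is an axisymmetric scalar. [folklore] -/
theorem isAxisymmetricScalar_ringPot (δ : ℝ) : IsAxisymmetricScalar (ringPot δ) := fun θ x => by
  simp only [ringPot, hsq_rotZ, rotZ_apply_two]

/-- **The ring pusher is AXISYMMETRIC.** [cite: MajdaBertozziCUP2002, §1.1 (vector identities)] -/
theorem isAxisymmetric_ringPusher (δ : ℝ) : IsAxisymmetric (ringPusher δ) :=
  (isAxisymmetric_smul_rotGenL (isAxisymmetricScalar_ringPot δ)).curl
    ((contDiff_ringPot_smul_rotGen δ).differentiable (by simp))

/-- **The ring pusher is SWIRL FREE.** [folklore] -/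
theorem hasNoSwirl_ringPusher (δ : ℝ) : HasNoSwirl (ringPusher δ) := fun x =>
  swirl_curl_smul_rotGenL (differentiable_ringPot δ x)

/-! ## §5 The shell region and the support -/

/-- **The shell region** `{s ≤ 3/4, 9/2 ≤ x₂ ≤ 11/2}` carrying the ring pusher (for `δ ≤ 1/4`). [folklore] -/
def ringRegion : Set (EuclideanSpace ℝ (Fin 3)) := {x | hsq x ≤ 3 / 4 ∧ 9 / 2 ≤ x 2 ∧ x 2 ≤ 11 / 2}

/-- The shell region is closed. [folklore] -/
theorem isClosed_ringRegion : IsClosed ringRegion := by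
  have h2 : Continuous fun x : EuclideanSpace ℝ (Fin 3) => x 2 :=
    (EuclideanSpace.proj (2 : Fin 3) : EuclideanSpace ℝ (Fin 3) →L[ℝ] ℝ).continuous
  exact (isClosed_le contDiff_hsq.continuous continuous_const).inter
    ((isClosed_le continuous_const h2).inter (isClosed_le h2 continuous_const))

/-- In the shell region `81/4 ≤ ‖x‖² ≤ 31`, so `9/2 ≤ ‖x‖ ≤ 28/5`. [folklore] -/
theorem norm_bounds_of_mem_ringRegion {x : EuclideanSpace ℝ (Fin 3)} (hx : x ∈ ringRegion) :
    9 / 2 ≤ ‖x‖ ∧ ‖x‖ ≤ 28 / 5 := by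
  obtain ⟨hs, h1, h2⟩ := hx
  have hsq := norm_sq_eq_hsq_add x
  have hs0 := hsq_nonneg x
  have hn := norm_nonneg x
  constructor
  · nlinarith
  · nlinarith

/-- Outside the shell region (`0 < δ ≤ 1/4`) the coefficients vanish: `f(s) = f′(s) = 0` or `η(t) = η′(t) = 0`.
[folklore] -/
theorem coeffs_eq_zero_of_notMem_ringRegion {δ : ℝ} (hδ : 0 < δ) (hδ4 : δ ≤ 1 / 4) {x : EuclideanSpace ℝ (Fin 3)}
    (hx : x ∉ ringRegion) :
    (ringRad (hsq x) = 0 ∧ deriv ringRad (hsq x) = 0) ∨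
      (ringAx ((x 2 - 5) / δ) = 0 ∧ deriv ringAx ((x 2 - 5) / δ) = 0) := by
  simp only [ringRegion, mem_setOf_eq, not_and_or, not_le] at hx
  rcases hx with hs | h2 | h2
  · exact Or.inl (ringRad_and_deriv_eq_zero_of_gt hs)
  · refine Or.inr (ringAx_and_deriv_eq_zero ?_)
    rw [abs_div, abs_of_pos hδ, lt_div_iff₀ hδ, abs_of_neg (by linarith)]
    linarith
  · refine Or.inr (ringAx_and_deriv_eq_zero ?_)
    rw [abs_div, abs_of_pos hδ, lt_div_iff₀ hδ, abs_of_pos (by linarith)]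
    linarith

/-- Outside the shell region `α_δ = 0` and `β_δ = 0`. [folklore] -/
theorem ringAlpha_ringBeta_eq_zero {δ : ℝ} (hδ : 0 < δ) (hδ4 : δ ≤ 1 / 4) {x : EuclideanSpace ℝ (Fin 3)}
    (hx : x ∉ ringRegion) : ringAlpha δ x = 0 ∧ ringBeta δ x = 0 := by
  rcases coeffs_eq_zero_of_notMem_ringRegion hδ hδ4 hx with ⟨h1, h2⟩ | ⟨h1, h2⟩
  · simp [ringAlpha, ringBeta, h1, h2]
  · simp [ringAlpha, ringBeta, h1, h2]

/-- **Confinement**: the ring pusher vanishes outside the shell region. [folklore] -/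
theorem ringPusher_eq_zero_of_notMem {δ : ℝ} (hδ : 0 < δ) (hδ4 : δ ≤ 1 / 4) {x : EuclideanSpace ℝ (Fin 3)}
    (hx : x ∉ ringRegion) : ringPusher δ x = 0 := by
  obtain ⟨ha, hb⟩ := ringAlpha_ringBeta_eq_zero hδ hδ4 hx
  ext i
  fin_cases i
  · simp [ringPusher_apply_zero, ha]
  · simp [ringPusher_apply_one, ha]
  · simp [ringPusher_apply_two, hb]

/-- **Support**: `tsupport (ringPusher δ) ⊆ ringRegion`. [folklore] -/
theorem tsupport_ringPusher_subset {δ : ℝ} (hδ : 0 < δ) (hδ4 : δ ≤ 1 / 4) : tsupport (ringPusher δ) ⊆ ringRegion := by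
  refine closure_minimal (fun x hx => ?_) isClosed_ringRegion
  by_contra h
  exact hx (ringPusher_eq_zero_of_notMem hδ hδ4 h)

/-- On the support: `9/2 ≤ ‖x‖ ≤ 28/5`. [folklore] -/
theorem norm_bounds_of_mem_tsupport_ringPusher {δ : ℝ} (hδ : 0 < δ) (hδ4 : δ ≤ 1 / 4) {x : EuclideanSpace ℝ (Fin 3)}
    (hx : x ∈ tsupport (ringPusher δ)) : 9 / 2 ≤ ‖x‖ ∧ ‖x‖ ≤ 28 / 5 :=
  norm_bounds_of_mem_ringRegion (tsupport_ringPusher_subset hδ hδ4 hx)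

/-- `tsupport (ringPusher δ) ⊆ B̄(0, 7)`. [folklore] -/
theorem tsupport_ringPusher_subset_closedBall {δ : ℝ} (hδ : 0 < δ) (hδ4 : δ ≤ 1 / 4) :
    tsupport (ringPusher δ) ⊆ closedBall (0 : EuclideanSpace ℝ (Fin 3)) 7 := fun x hx => by
  rw [mem_closedBall, dist_zero_right]
  linarith [(norm_bounds_of_mem_tsupport_ringPusher hδ hδ4 hx).2]

/-- **The ring pusher has compact support.** [folklore] -/
theorem hasCompactSupport_ringPusher {δ : ℝ} (hδ : 0 < δ) (hδ4 : δ ≤ 1 / 4) : HasCompactSupport (ringPusher δ) :=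
  (isCompact_closedBall (0 : EuclideanSpace ℝ (Fin 3)) 7).of_isClosed_subset (isClosed_tsupport _)
    (tsupport_ringPusher_subset_closedBall hδ hδ4)

/-- The ring pusher vanishes on the ball `‖x‖ < 9/2` (in particular near the origin and on `‖x‖ < 15/4`). [folklore] -/
theorem ringPusher_eq_zero_of_norm_lt {δ : ℝ} (hδ : 0 < δ) (hδ4 : δ ≤ 1 / 4) {x : EuclideanSpace ℝ (Fin 3)}
    (hx : ‖x‖ < 9 / 2) : ringPusher δ x = 0 :=
  ringPusher_eq_zero_of_notMem hδ hδ4 fun h => (not_le.2 hx) (norm_bounds_of_mem_ringRegion h).1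

/-! ## §6 A uniform speed bound -/

/-- **A speed bound**: there is `M ≥ 0` with `‖ringPusher δ x‖ ≤ M` for all `x` (continuity and compact support).
[folklore] -/
theorem exists_norm_ringPusher_le {δ : ℝ} (hδ : 0 < δ) (hδ4 : δ ≤ 1 / 4) :
    ∃ M : ℝ, 0 ≤ M ∧ ∀ x, ‖ringPusher δ x‖ ≤ M := by
  obtain ⟨M, hM⟩ := (hasCompactSupport_ringPusher hδ hδ4).exists_bound_of_continuous (continuous_ringPusher δ)
  exact ⟨max M 0, le_max_right _ _, fun x => (hM x).trans (le_max_left _ _)⟩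

end Summit.NavierStokesRegularity.FluidComputer.PalasekTowerClayBridge.Germ

end
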